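import Literature.NumberTheory.LFunctions.Zhang2022.DetectorRecipeCertificate
import Literature.NumberTheory.LFunctions.Zhang2022.DetectorRecipeCertificateSchur
import Literature.NumberTheory.LFunctions.Zhang2022.DetectorEntangledCone

/-!
# Zhang (2022), programme F-S3 (cell landau-siegel §E): the `FormDetPSD` certificate format of
# `DetectorRecipeCertificate` with the SIX CHANNEL MOMENTS AS PARAMETERS — so that it applies to the confluent
# (repeated-shift) recipe forms `Det.FormDetDD` and to the `K = 1` members `Det.ConePSD a ![x]` of the row E-102

Y. Zhang, *Discrete mean estimates and the Landau–Siegel zero*, arXiv:2211.02515v1 [Zhang2022LandauSiegel] —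
an unrefereed manuscript under adjudication. **WHAT THIS IS NOT: not a claim about Theorems 1–2 of
arXiv:2211.02515, about Landau–Siegel zeros, about a repaired `Margin232`, or about Parity; nothing here asserts
any claim of the manuscript, any estimate, or any slot — in particular NOT the row E-102 (`Det.EdetCone`) and not
any of its members. The programme SEARCHES and TYPES; no claim about Landau–Siegel zeros, Theorems 1–2 of
arXiv:2211.02515 or a repaired Margin232 until a kernel theorem says so.**

`DetectorRecipeCertificate` (ls-barrier-p6, p468669) types the linear–quadratic (second-variation) certificate for
`Det.FormDetPSD R`, `R : DetRecipe` (three DISTINCT shifts): `formDet_eq_integral_pointwise` +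
`formDetPSD_of_certificate`, used at `b⋆ = (½; 2, 5/2)` in `RepairDetShiftPSD` (p473995). Its proofs only ever see
the recipe through its six channel moments `(m₀, m_s, m_n, m_b, m_bs, m_bn) = (ΣW, ΣWs, ΣWn, ΣWb, ΣWbs, ΣWbn)`
(`Det.formDet_eq_moments`). THIS FILE restates the format with those six moments as free complex parameters —
`pwFormOf` / `certFormOf` / `bdFormOf`, `sixMomentOf_eq_integral_pointwise`, `sixMomentOf_nonneg_of_certificate`,
`certFormOf_eq_hermForm3` (the `3 × 3` Hermitian shape consumed by `Det.hermForm3_nonneg_of_schur`) — and records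
the two corollaries the B-det word's premise row needs member by member:

* `formDetDD_nonneg_of_certificate` — a certificate for the divided-difference moments of ANY real triple `b`
  (repeats allowed; `Det.FormDetDD b := SixMomentOf (ddM0 b) (ddMs b) (ddMn b) (ddMb b) (ddMbs b) (ddMbn b)`,
  `DetectorShiftMomentsDD` p470349) proves `FormDetDD b ≥ 0` on one-sided kinked profiles;
* `conePSD_fin_one_of_certificate` — hence a certificate for the triple `(a, x, x)` proves the `K = 1` member
  `Det.ConePSD a ![x]` of `Det.EdetCone` (registry E-102, `DetectorEntangledCone` p473997; `Det.conePSD_fin_one_iff`),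
  i.e. the diagonal / «SOS rank-one slice» generators named in the word KILL(B-det) (director-frontier
  2026-08-26T23:09:45Z, §1a re-said 23:27:01Z) become decidable BY THE KERNEL one member at a time once a polynomial
  sub-solution `K` is supplied (cell: barrier-num's generator; the dd-moments of `(a,x,x)` at `a = ½`, `x ∈ ¼ℤ`
  lie in `ℚ(√2, i)[π]`, so each instance's scalar inequalities need interval bounds on `√2` and `π` — instances are
  NOT in this file).

Consistency: `pwForm R = pwFormOf (moments of R)` etc. hold by `rfl` (`pwForm_eq_pwFormOf`, `certForm_eq_certFormOf`,
`bdForm_eq_bdFormOf`), so p6's `formDetPSD_of_certificate` is the special case `R.W`-moments of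
`sixMomentOf_nonneg_of_certificate` (`formDetPSD_of_certificate'`, one line). Elementary calculus (fundamental
theorem of calculus for right derivatives on the kinked class, two completions of squares); no numerics; standard
axioms; 0 named facts. Cell landau-siegel, ls-Bmulti-typer-2 g3 (§E typer; OFFER (B) 2026-08-27T00:02:42Z).

References: Y. Zhang, arXiv:2211.02515v1 (2022), Prop. 7.1 with (8.11)–(8.23) [pp. 44–50]; §2 (2.16), Lemma 2.3;
proof of Prop. 7.1 (7.19)–(7.21) (repeated shifts). [cite: Zhang2022LandauSiegel, §7 Prop. 7.1, §8 (8.11)–(8.23)]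
-/

noncomputable section

open Complex Real ComplexConjugate Set intervalIntegral
open _root_.MeasureTheory

namespace Literature.NumberTheory.LFunctions.Zhang2022

namespace Det

open Repair

variable {g g' : ℝ → ℂ}

/-! ### The pointwise forms with the six moments as parameters -/

/-- **The pointwise Hermitian form of a six-moment expression** in the atoms `w = T(y) = ∫_y^1 g`, `v = g(y)`,
`u = g′(y)`: `ℓ = (2/π)Re(m₀)|u|² + 2Im(m_s u v̄) − 2Im(m_b v ū) + 2πRe(m_n + m_bs)|v|² − 2π²Im(m_bn v w̄)` —
`Det.pwForm` with the recipe's channel moments replaced by parameters.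
[cite: Zhang2022LandauSiegel, Prop 7.1 with (8.11)–(8.23), pp.44–50] -/
def pwFormOf (m0 ms mn mb mbs mbn : ℂ) (w v u : ℂ) : ℝ :=
  2 / π * m0.re * ‖u‖ ^ 2
    + 2 * (ms * (u * conj v)).im
    - 2 * (mb * (v * conj u)).im
    + 2 * π * (mn + mbs).re * ‖v‖ ^ 2
    - 2 * π ^ 2 * (mbn * (v * conj w)).im

/-- **The certificate form** of a six-moment expression: `ℓ(w,v,u)` plus the `y`-derivative of
`k₁₁|T|² + 2Re(k₁₂T̄g) + k₂₂|g|²` along `T′ = −g`, `g′ = u`, in the VALUES `(k₁₁, k₁₁′, k₂₂, k₂₂′, k₁₂, k₁₂′)`.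
[cite: Zhang2022LandauSiegel, Prop 7.1 with (8.11)–(8.23), pp.44–50] -/
def certFormOf (m0 ms mn mb mbs mbn : ℂ) (k11 k11' k22 k22' : ℝ) (k12 k12' : ℂ) (w v u : ℂ) : ℝ :=
  pwFormOf m0 ms mn mb mbs mbn w v u
    + (k11' * ‖w‖ ^ 2 + 2 * (k12' * (conj w * v)).re - 2 * k11 * (conj w * v).re + k22' * ‖v‖ ^ 2
        - 2 * k12.re * ‖v‖ ^ 2 + 2 * (k12 * (conj w * u)).re + 2 * k22 * (conj v * u).re)

/-- **The boundary form** at `y = 0` in `(a, b) = (T(0), g(0))`: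
`k₁₁(0)|a|² + 2Re(k₁₂(0)āb) + k₂₂(0)|b|² − 2πRe(m_n b ā)` (only the moment `m_n` enters).
[cite: Zhang2022LandauSiegel, Prop 7.1 with (8.11)–(8.23), pp.44–50] -/
def bdFormOf (mn : ℂ) (h11 h22 : ℝ) (h12 : ℂ) (a b : ℂ) : ℝ :=
  h11 * ‖a‖ ^ 2 + 2 * (h12 * (conj a * b)).re + h22 * ‖b‖ ^ 2 - 2 * π * (mn * (b * conj a)).re

/-- `Det.pwForm R` IS `pwFormOf` at the recipe's channel moments (definitional).
[cite: Zhang2022LandauSiegel, Prop 7.1 with (8.11)–(8.23), pp.44–50] -/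
theorem pwForm_eq_pwFormOf (R : DetRecipe) (w v u : ℂ) :
    pwForm R w v u = pwFormOf (∑ j : Fin 3, R.W j) (∑ j : Fin 3, R.W j * (R.s j : ℂ))
      (∑ j : Fin 3, R.W j * (R.n j : ℂ)) (∑ j : Fin 3, R.W j * (R.b j : ℂ))
      (∑ j : Fin 3, R.W j * ((R.b j : ℂ) * (R.s j : ℂ))) (∑ j : Fin 3, R.W j * ((R.b j : ℂ) * (R.n j : ℂ)))
      w v u := rfl

/-- `Det.certForm R` IS `certFormOf` at the recipe's channel moments (definitional).
[cite: Zhang2022LandauSiegel, Prop 7.1 with (8.11)–(8.23), pp.44–50] -/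
theorem certForm_eq_certFormOf (R : DetRecipe) (k11 k11' k22 k22' : ℝ) (k12 k12' : ℂ) (w v u : ℂ) :
    certForm R k11 k11' k22 k22' k12 k12' w v u
      = certFormOf (∑ j : Fin 3, R.W j) (∑ j : Fin 3, R.W j * (R.s j : ℂ))
          (∑ j : Fin 3, R.W j * (R.n j : ℂ)) (∑ j : Fin 3, R.W j * (R.b j : ℂ))
          (∑ j : Fin 3, R.W j * ((R.b j : ℂ) * (R.s j : ℂ))) (∑ j : Fin 3, R.W j * ((R.b j : ℂ) * (R.n j : ℂ)))
          k11 k11' k22 k22' k12 k12' w v u := rfl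

/-- `Det.bdForm R` IS `bdFormOf` at the recipe's moment `m_n` (definitional).
[cite: Zhang2022LandauSiegel, Prop 7.1 with (8.11)–(8.23), pp.44–50] -/
theorem bdForm_eq_bdFormOf (R : DetRecipe) (h11 h22 : ℝ) (h12 : ℂ) (a b : ℂ) :
    bdForm R h11 h22 h12 a b = bdFormOf (∑ j : Fin 3, R.W j * (R.n j : ℂ)) h11 h22 h12 a b := rfl

/-! ### Integrability bookkeeping (the private helpers of `DetectorRecipeCertificate`, restated) -/

/-- Real part of an integrable function is interval-integrable. [folklore] -/
private theorem intervalIntegrable_re_comp' {F : ℝ → ℂ} {a b : ℝ} (h : IntervalIntegrable F volume a b) :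
    IntervalIntegrable (fun x => (F x).re) volume a b :=
  ⟨h.1.re, h.2.re⟩

/-- `∫ (c·F).im = (c·∫F).im` on `[0,1]`. [folklore] -/
private theorem integral_im_const_mul' {F : ℝ → ℂ} (h : IntervalIntegrable F volume 0 1) (c : ℂ) :
    ∫ x in (0:ℝ)..1, (c * F x).im = (c * ∫ x in (0:ℝ)..1, F x).im := by
  rw [← intervalIntegral.integral_const_mul]
  have := intervalIntegral.intervalIntegral_im (h.const_mul c)
  simpa using this

/-- `(conj ∘ h)` inherits a right derivative. [folklore] -/
private theorem hasDerivWithinAt_conj_comp' {h : ℝ → ℂ} {h' : ℂ} {s : Set ℝ} {x : ℝ}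
    (hh : HasDerivWithinAt h h' s x) : HasDerivWithinAt (fun x => conj (h x)) (conj h') s x := by
  simpa using hh.star

/-- The parametric pointwise form is integrable along `(T, g, g′)` for a kinked profile. [folklore] -/
private theorem intervalIntegrable_pwFormOf (m0 ms mn mb mbs mbn : ℂ) (hg : KinkedProfile g g') :
    IntervalIntegrable (fun y => pwFormOf m0 ms mn mb mbs mbn (∫ t in y..(1:ℝ), g t) (g y) (g' y))
      volume 0 1 := by
  have hH := hg.isH1
  have i1 : IntervalIntegrable (fun y => ‖g' y‖ ^ 2) volume 0 1 := hH.intervalIntegrable_sq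
  have i2 : IntervalIntegrable (fun y => g' y * conj (g y)) volume 0 1 :=
    IsH1OnUnitInterval.intervalIntegrable_deriv_mul_conj hH hH
  have i4 : IntervalIntegrable (fun y => g y * conj (g' y)) volume 0 1 := by
    have hch' : IntervalIntegrable (fun x => conj (g' x)) volume 0 1 := by
      rw [intervalIntegrable_iff, uIoc_of_le zero_le_one]
      exact hH.memLp_conj.integrable one_le_two
    exact hch'.continuousOn_mul (by rw [uIcc_of_le zero_le_one]; exact hg.cont)
  have i5 : IntervalIntegrable (fun y => ‖g y‖ ^ 2) volume 0 1 :=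
    ((hg.cont.norm).pow 2).intervalIntegrable_of_Icc zero_le_one
  have i7 : IntervalIntegrable (fun y => g y * conj (∫ t in y..(1:ℝ), g t)) volume 0 1 :=
    (hg.cont.mul (continuousOn_conj_comp (continuousOn_tail_unit hg.cont))).intervalIntegrable_of_Icc
      zero_le_one
  have j2 : IntervalIntegrable (fun y => (ms * (g' y * conj (g y))).im) volume 0 1 :=
    (intervalIntegrable_re_comp' ((i2.const_mul ms).const_mul (-I))).congr_uIoo
      fun y _ => by simp [Complex.mul_re, Complex.mul_im]
  have j3 : IntervalIntegrable (fun y => (mb * (g y * conj (g' y))).im) volume 0 1 :=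
    (intervalIntegrable_re_comp' ((i4.const_mul mb).const_mul (-I))).congr_uIoo
      fun y _ => by simp [Complex.mul_re, Complex.mul_im]
  have j5 : IntervalIntegrable (fun y => (mbn * (g y * conj (∫ t in y..(1:ℝ), g t))).im) volume 0 1 :=
    (intervalIntegrable_re_comp' ((i7.const_mul mbn).const_mul (-I))).congr_uIoo
      fun y _ => by simp [Complex.mul_re, Complex.mul_im]
  exact ((((i1.const_mul _).add (j2.const_mul 2)).sub (j3.const_mul 2)).add (i5.const_mul _)).sub
    (j5.const_mul _)

/-! ### The six-moment expression as the integral of its pointwise form -/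

/-- **`SixMomentOf` as the integral of its pointwise form plus the boundary term at `y = 0`** (kinked `g`,
continuous on `[0,1]` with an `L²` right derivative; no apex condition is needed for this identity):
`SixMoment(g) = ∫₀¹ ℓ(T, g, g′) − 2πRe(m_n g(0) conj T(0))`, `T(y) = ∫_y^1 g`.
[cite: Zhang2022LandauSiegel, Prop 7.1 with (8.11)–(8.23), pp.44–50] -/
theorem sixMomentOf_eq_integral_pointwise (m0 ms mn mb mbs mbn : ℂ) (hg : KinkedProfile g g') :
    SixMomentOf m0 ms mn mb mbs mbn g g'
      = (∫ y in (0:ℝ)..1, pwFormOf m0 ms mn mb mbs mbn (∫ t in y..(1:ℝ), g t) (g y) (g' y))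
        - 2 * π * (mn * (g 0 * conj (∫ t in (0:ℝ)..1, g t))).re := by
  have hH := hg.isH1
  -- integrability of the five atoms
  have i1 : IntervalIntegrable (fun y => ‖g' y‖ ^ 2) volume 0 1 := hH.intervalIntegrable_sq
  have i2 : IntervalIntegrable (fun y => g' y * conj (g y)) volume 0 1 :=
    IsH1OnUnitInterval.intervalIntegrable_deriv_mul_conj hH hH
  have i4 : IntervalIntegrable (fun y => g y * conj (g' y)) volume 0 1 := by
    have hch' : IntervalIntegrable (fun x => conj (g' x)) volume 0 1 := by
      rw [intervalIntegrable_iff, uIoc_of_le zero_le_one]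
      exact hH.memLp_conj.integrable one_le_two
    exact hch'.continuousOn_mul (by rw [uIcc_of_le zero_le_one]; exact hg.cont)
  have i5 : IntervalIntegrable (fun y => ‖g y‖ ^ 2) volume 0 1 :=
    ((hg.cont.norm).pow 2).intervalIntegrable_of_Icc zero_le_one
  have i7 : IntervalIntegrable (fun y => g y * conj (∫ t in y..(1:ℝ), g t)) volume 0 1 :=
    (hg.cont.mul (continuousOn_conj_comp (continuousOn_tail_unit hg.cont))).intervalIntegrable_of_Icc
      zero_le_one
  -- the integral of the pointwise form, term by term
  have e1 : (∫ y in (0:ℝ)..1, 2 / π * m0.re * ‖g' y‖ ^ 2) = 2 / π * m0.re * ∫ y in (0:ℝ)..1, ‖g' y‖ ^ 2 :=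
    intervalIntegral.integral_const_mul _ _
  have e2 : (∫ y in (0:ℝ)..1, 2 * (ms * (g' y * conj (g y))).im)
      = 2 * (ms * ∫ y in (0:ℝ)..1, g' y * conj (g y)).im := by
    rw [intervalIntegral.integral_const_mul, integral_im_const_mul' i2]
  have e3 : (∫ y in (0:ℝ)..1, 2 * (mb * (g y * conj (g' y))).im)
      = 2 * (mb * ∫ y in (0:ℝ)..1, g y * conj (g' y)).im := by
    rw [intervalIntegral.integral_const_mul, integral_im_const_mul' i4]
  have e4 : (∫ y in (0:ℝ)..1, 2 * π * (mn + mbs).re * ‖g y‖ ^ 2)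
      = 2 * π * (mn + mbs).re * ∫ y in (0:ℝ)..1, ‖g y‖ ^ 2 :=
    intervalIntegral.integral_const_mul _ _
  have e5 : (∫ y in (0:ℝ)..1, 2 * π ^ 2 * (mbn * (g y * conj (∫ t in y..(1:ℝ), g t))).im)
      = 2 * π ^ 2 * (mbn * ∫ y in (0:ℝ)..1, g y * conj (∫ t in y..(1:ℝ), g t)).im := by
    rw [intervalIntegral.integral_const_mul, integral_im_const_mul' i7]
  -- integrability of the five terms
  have j1 : IntervalIntegrable (fun y => 2 / π * m0.re * ‖g' y‖ ^ 2) volume 0 1 := i1.const_mul _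
  have j2 : IntervalIntegrable (fun y => 2 * (ms * (g' y * conj (g y))).im) volume 0 1 :=
    ((intervalIntegrable_re_comp' ((i2.const_mul ms).const_mul (-I))).const_mul 2).congr_uIoo
      fun y _ => by simp [Complex.mul_im, Complex.mul_re]
  have j3 : IntervalIntegrable (fun y => 2 * (mb * (g y * conj (g' y))).im) volume 0 1 :=
    ((intervalIntegrable_re_comp' ((i4.const_mul mb).const_mul (-I))).const_mul 2).congr_uIoo
      fun y _ => by simp [Complex.mul_im, Complex.mul_re]
  have j4 : IntervalIntegrable (fun y => 2 * π * (mn + mbs).re * ‖g y‖ ^ 2) volume 0 1 := i5.const_mul _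
  have j5 : IntervalIntegrable
      (fun y => 2 * π ^ 2 * (mbn * (g y * conj (∫ t in y..(1:ℝ), g t))).im) volume 0 1 :=
    ((intervalIntegrable_re_comp' ((i7.const_mul mbn).const_mul (-I))).const_mul (2 * π ^ 2)).congr_uIoo
      fun y _ => by simp [Complex.mul_im, Complex.mul_re]
  have key : (∫ y in (0:ℝ)..1, pwFormOf m0 ms mn mb mbs mbn (∫ t in y..(1:ℝ), g t) (g y) (g' y))
      = 2 / π * m0.re * (∫ y in (0:ℝ)..1, ‖g' y‖ ^ 2)
        + 2 * (ms * ∫ y in (0:ℝ)..1, g' y * conj (g y)).im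
        - 2 * (mb * ∫ y in (0:ℝ)..1, g y * conj (g' y)).im
        + 2 * π * (mn + mbs).re * (∫ y in (0:ℝ)..1, ‖g y‖ ^ 2)
        - 2 * π ^ 2 * (mbn * ∫ y in (0:ℝ)..1, g y * conj (∫ t in y..(1:ℝ), g t)).im := by
    have hpw : ∀ y, pwFormOf m0 ms mn mb mbs mbn (∫ t in y..(1:ℝ), g t) (g y) (g' y)
        = 2 / π * m0.re * ‖g' y‖ ^ 2 + 2 * (ms * (g' y * conj (g y))).im
          - 2 * (mb * (g y * conj (g' y))).im + 2 * π * (mn + mbs).re * ‖g y‖ ^ 2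
          - 2 * π ^ 2 * (mbn * (g y * conj (∫ t in y..(1:ℝ), g t))).im := fun y => rfl
    simp_rw [hpw]
    rw [intervalIntegral.integral_sub (((j1.add j2).sub j3).add j4) j5,
      intervalIntegral.integral_add ((j1.add j2).sub j3) j4,
      intervalIntegral.integral_sub (j1.add j2) j3, intervalIntegral.integral_add j1 j2,
      e1, e2, e3, e4, e5]
  rw [key, SixMomentOf, atom7_eq_tail hg.cont]
  ring

/-! ### The certificate theorem with the six moments as parameters -/

/-- **Non-negativity of a six-moment expression from an LQ certificate.** Let `k₁₁, k₂₂ : ℝ → ℝ` and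
`k₁₂ : ℝ → ℂ` be differentiable with continuous derivatives `k₁₁′, k₂₂′, k₁₂′`. If (pointwise)
`certFormOf m (k(y), k′(y)) (w, v, u) ≥ 0` for all `y ∈ [0,1]`, `w, v, u ∈ ℂ`, and (boundary)
`bdFormOf m_n (k₁₁(0), k₂₂(0), k₁₂(0)) (a, b) ≥ 0` for all `a, b ∈ ℂ`, then `SixMomentOf m g g′ ≥ 0` for every
one-sided kinked profile (`g(1) = 0`): `SixMoment(g) = ∫₀¹ certFormOf(…)(T, g, g′) dy + bdFormOf(…)(T(0), g(0))` by
`sixMomentOf_eq_integral_pointwise` and the fundamental theorem of calculus for `Φ = k₁₁|T|² + 2Re(k₁₂T̄g) + k₂₂|g|²`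
(`Φ(1) = 0`). The proof is `Det.formDetPSD_of_certificate`'s, verbatim in the parameters.
[cite: Zhang2022LandauSiegel, Prop 7.1 with (8.11)–(8.23), pp.44–50; §2 (2.16)] -/
theorem sixMomentOf_nonneg_of_certificate (m0 ms mn mb mbs mbn : ℂ)
    (k11 k22 k11' k22' : ℝ → ℝ) (k12 k12' : ℝ → ℂ)
    (hk11 : ∀ y, HasDerivAt k11 (k11' y) y) (hk22 : ∀ y, HasDerivAt k22 (k22' y) y)
    (hk12 : ∀ y, HasDerivAt k12 (k12' y) y)
    (hc11 : Continuous k11') (hc22 : Continuous k22') (hc12 : Continuous k12')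
    (HP : ∀ y ∈ Icc (0:ℝ) 1, ∀ w v u : ℂ,
      0 ≤ certFormOf m0 ms mn mb mbs mbn (k11 y) (k11' y) (k22 y) (k22' y) (k12 y) (k12' y) w v u)
    (HB : ∀ a b : ℂ, 0 ≤ bdFormOf mn (k11 0) (k22 0) (k12 0) a b)
    {g g' : ℝ → ℂ} (hg : KinkedProfile g g') (hg1 : g 1 = 0) :
    0 ≤ SixMomentOf m0 ms mn mb mbs mbn g g' := by
  -- continuity of the `k`'s
  have ck11 : Continuous k11 := continuous_iff_continuousAt.2 fun y => (hk11 y).continuousAt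
  have ck22 : Continuous k22 := continuous_iff_continuousAt.2 fun y => (hk22 y).continuousAt
  have ck12 : Continuous k12 := continuous_iff_continuousAt.2 fun y => (hk12 y).continuousAt
  -- the tail primitive and its calculus
  set T : ℝ → ℂ := fun y => ∫ t in y..(1:ℝ), g t with hT
  have hTc : ContinuousOn T (Icc 0 1) := continuousOn_tail_unit hg.cont
  have hT1 : T 1 = 0 := by simp [hT]
  have hTd : ∀ x ∈ Ioo (0:ℝ) 1, HasDerivAt T (-g x) x := fun x hx => hasDerivAt_tail_unit hg.cont hx
  -- the potential Φ (complex-valued, real in value) and its right derivative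
  set Φ : ℝ → ℂ := fun y => (k11 y : ℂ) * (T y * conj (T y))
      + (k12 y * (conj (T y) * g y) + conj (k12 y * (conj (T y) * g y)))
      + (k22 y : ℂ) * (g y * conj (g y)) with hΦ
  set dΦ : ℝ → ℂ := fun y => ((k11' y : ℂ) * (T y * conj (T y)) + (k11 y : ℂ) * (-g y * conj (T y) + T y * conj (-g y)))
      + ((k12' y * (conj (T y) * g y) + k12 y * (conj (-g y) * g y + conj (T y) * g' y))
          + conj (k12' y * (conj (T y) * g y) + k12 y * (conj (-g y) * g y + conj (T y) * g' y)))
      + ((k22' y : ℂ) * (g y * conj (g y)) + (k22 y : ℂ) * (g' y * conj (g y) + g y * conj (g' y))) with hdΦ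
  have hΦ1 : Φ 1 = 0 := by simp [hΦ, hT1, hg1]
  have hΦc : ContinuousOn Φ (Icc 0 1) := by
    have hgc := hg.cont
    have hTcc := continuousOn_conj_comp hTc
    have hgcc := continuousOn_conj_comp hgc
    refine ((((Complex.continuous_ofReal.comp ck11).continuousOn).mul (hTc.mul hTcc)).add
      (((ck12.continuousOn.mul (hTcc.mul hgc))).add
        (continuousOn_conj_comp (ck12.continuousOn.mul (hTcc.mul hgc))))).add
      (((Complex.continuous_ofReal.comp ck22).continuousOn).mul (hgc.mul hgcc))
  have hΦd : ∀ x ∈ Ioo (0:ℝ) 1, HasDerivWithinAt Φ (dΦ x) (Ioi x) x := by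
    intro x hx
    have dT : HasDerivWithinAt T (-g x) (Ioi x) x := (hTd x hx).hasDerivWithinAt
    have dTc : HasDerivWithinAt (fun y => conj (T y)) (conj (-g x)) (Ioi x) x := hasDerivWithinAt_conj_comp' dT
    have dg : HasDerivWithinAt g (g' x) (Ioi x) x := hg.hasDeriv x hx
    have dgc : HasDerivWithinAt (fun y => conj (g y)) (conj (g' x)) (Ioi x) x := hasDerivWithinAt_conj_comp' dg
    have d11 : HasDerivWithinAt (fun y => (k11 y : ℂ)) (k11' x) (Ioi x) x :=
      (hk11 x).ofReal_comp.hasDerivWithinAt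
    have d22 : HasDerivWithinAt (fun y => (k22 y : ℂ)) (k22' x) (Ioi x) x :=
      (hk22 x).ofReal_comp.hasDerivWithinAt
    have d12 : HasDerivWithinAt k12 (k12' x) (Ioi x) x := (hk12 x).hasDerivWithinAt
    have t1 := d11.mul (dT.mul dTc)
    have t2a := d12.mul (dTc.mul dg)
    have t2 := t2a.add (hasDerivWithinAt_conj_comp' t2a)
    have t3 := d22.mul (dg.mul dgc)
    exact (t1.add t2).add t3
  -- integrability of dΦ
  have hdΦi : IntervalIntegrable dΦ volume 0 1 := by
    have hgc := hg.cont
    have hTcc := continuousOn_conj_comp hTc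
    have hgcc := continuousOn_conj_comp hgc
    have hg'i : IntervalIntegrable g' volume 0 1 := hg.isH1.intervalIntegrable
    have hg'ci : IntervalIntegrable (fun x => conj (g' x)) volume 0 1 := by
      rw [intervalIntegrable_iff, uIoc_of_le zero_le_one]
      exact hg.isH1.memLp_conj.integrable one_le_two
    have hI : uIcc (0:ℝ) 1 = Icc 0 1 := uIcc_of_le zero_le_one
    -- continuous pieces
    have c1 : ContinuousOn (fun y => (k11' y : ℂ) * (T y * conj (T y))
        + (k11 y : ℂ) * (-g y * conj (T y) + T y * conj (-g y))) (Icc 0 1) :=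
      (((Complex.continuous_ofReal.comp hc11).continuousOn).mul (hTc.mul hTcc)).add
        (((Complex.continuous_ofReal.comp ck11).continuousOn).mul
          ((hgc.neg.mul hTcc).add (hTc.mul (continuousOn_conj_comp hgc.neg))))
    have c2 : ContinuousOn (fun y => k12' y * (conj (T y) * g y) + k12 y * (conj (-g y) * g y)) (Icc 0 1) :=
      (hc12.continuousOn.mul (hTcc.mul hgc)).add (ck12.continuousOn.mul ((continuousOn_conj_comp hgc.neg).mul hgc))
    have c4 : ContinuousOn (fun y => (k22' y : ℂ) * (g y * conj (g y))) (Icc 0 1) :=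
      ((Complex.continuous_ofReal.comp hc22).continuousOn).mul (hgc.mul hgcc)
    have c5 : ContinuousOn (fun y => (k22 y : ℂ) * conj (g y)) (Icc 0 1) :=
      ((Complex.continuous_ofReal.comp ck22).continuousOn).mul hgcc
    have c6 : ContinuousOn (fun y => (k22 y : ℂ) * g y) (Icc 0 1) :=
      ((Complex.continuous_ofReal.comp ck22).continuousOn).mul hgc
    have c3 : ContinuousOn (fun y => k12 y * conj (T y)) (Icc 0 1) := ck12.continuousOn.mul hTcc
    -- pieces with g'
    have p1 : IntervalIntegrable (fun y => k12' y * (conj (T y) * g y) + k12 y * (conj (-g y) * g y)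
        + k12 y * conj (T y) * g' y) volume 0 1 :=
      (c2.intervalIntegrable_of_Icc zero_le_one).add (hg'i.continuousOn_mul (by rwa [hI]))
    have p1c : IntervalIntegrable (fun y => conj (k12' y * (conj (T y) * g y) + k12 y * (conj (-g y) * g y)
        + k12 y * conj (T y) * g' y)) volume 0 1 := by
      rw [intervalIntegrable_iff] at p1 ⊢
      exact (Complex.conjCLE.toContinuousLinearMap).integrable_comp p1
    have p3 : IntervalIntegrable (fun y => (k22' y : ℂ) * (g y * conj (g y))
        + ((k22 y : ℂ) * conj (g y) * g' y + (k22 y : ℂ) * g y * conj (g' y))) volume 0 1 :=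
      (c4.intervalIntegrable_of_Icc zero_le_one).add
        ((hg'i.continuousOn_mul (by rwa [hI])).add (hg'ci.continuousOn_mul (by rwa [hI])))
    have := ((c1.intervalIntegrable_of_Icc zero_le_one).add (p1.add p1c)).add p3
    refine this.congr_uIoo fun y _ => ?_
    simp only [hdΦ, map_add, map_mul]
    ring
  -- FTC: ∫ dΦ = Φ 1 − Φ 0 = −Φ 0
  have ftc : ∫ y in (0:ℝ)..1, dΦ y = Φ 1 - Φ 0 :=
    intervalIntegral.integral_eq_sub_of_hasDeriv_right_of_le zero_le_one hΦc hΦd hdΦi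
  -- real parts: (dΦ y).re is the `k`-part of certFormOf, (Φ 0).re is the `k`-part of bdFormOf
  have hre : ∀ y, (dΦ y).re
      = certFormOf m0 ms mn mb mbs mbn (k11 y) (k11' y) (k22 y) (k22' y) (k12 y) (k12' y) (T y) (g y) (g' y)
          - pwFormOf m0 ms mn mb mbs mbn (T y) (g y) (g' y) := by
    intro y
    simp only [hdΦ, certFormOf, Complex.sq_norm, Complex.normSq_apply, Complex.add_re, Complex.add_im,
      Complex.mul_re, Complex.mul_im, Complex.conj_re, Complex.conj_im,
      Complex.ofReal_re, Complex.ofReal_im, Complex.neg_re, Complex.neg_im, map_add, map_mul,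
      Complex.conj_conj]
    ring
  have hre0 : (Φ 0).re = bdFormOf mn (k11 0) (k22 0) (k12 0) (T 0) (g 0)
      + 2 * π * (mn * (g 0 * conj (T 0))).re := by
    simp only [hΦ, bdFormOf, Complex.sq_norm, Complex.normSq_apply, Complex.add_re,
      Complex.mul_re, Complex.mul_im, Complex.conj_re, Complex.conj_im,
      Complex.ofReal_re, Complex.ofReal_im, map_mul, Complex.conj_conj]
    ring
  -- integral of the real part
  have hint_re : ∫ y in (0:ℝ)..1, (dΦ y).re = -(Φ 0).re := by
    have := intervalIntegral.intervalIntegral_re hdΦi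
    simp only [RCLike.re_to_complex] at this
    rw [this, ftc, hΦ1, zero_sub, Complex.neg_re]
  have hcert_nonneg : 0 ≤ ∫ y in (0:ℝ)..1,
      certFormOf m0 ms mn mb mbs mbn (k11 y) (k11' y) (k22 y) (k22' y) (k12 y) (k12' y) (T y) (g y) (g' y) :=
    intervalIntegral.integral_nonneg zero_le_one fun y hy => HP y hy _ _ _
  have hsplit : (∫ y in (0:ℝ)..1, pwFormOf m0 ms mn mb mbs mbn (T y) (g y) (g' y))
      = (∫ y in (0:ℝ)..1,
          certFormOf m0 ms mn mb mbs mbn (k11 y) (k11' y) (k22 y) (k22' y) (k12 y) (k12' y) (T y) (g y) (g' y))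
        - ∫ y in (0:ℝ)..1, (dΦ y).re := by
    have hdre : IntervalIntegrable (fun y => (dΦ y).re) volume 0 1 := intervalIntegrable_re_comp' hdΦi
    have hpw_eq : (fun y => pwFormOf m0 ms mn mb mbs mbn (T y) (g y) (g' y))
        = fun y => certFormOf m0 ms mn mb mbs mbn (k11 y) (k11' y) (k22 y) (k22' y) (k12 y) (k12' y)
            (T y) (g y) (g' y) - (dΦ y).re := by
      funext y; rw [hre y]; ring
    have hpwi : IntervalIntegrable (fun y => pwFormOf m0 ms mn mb mbs mbn (T y) (g y) (g' y)) volume 0 1 :=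
      intervalIntegrable_pwFormOf m0 ms mn mb mbs mbn hg
    have hci : IntervalIntegrable
        (fun y => certFormOf m0 ms mn mb mbs mbn (k11 y) (k11' y) (k22 y) (k22' y) (k12 y) (k12' y)
          (T y) (g y) (g' y)) volume 0 1 := by
      have := hpwi.add hdre
      refine this.congr_uIoo fun y _ => ?_
      show pwFormOf m0 ms mn mb mbs mbn (T y) (g y) (g' y) + (dΦ y).re = _
      rw [hre y]; ring
    rw [hpw_eq, intervalIntegral.integral_sub hci hdre]
  -- assemble
  rw [sixMomentOf_eq_integral_pointwise m0 ms mn mb mbs mbn hg, hsplit, hint_re, hre0]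
  have hb := HB (T 0) (g 0)
  linarith

/-- **p6's `formDetPSD_of_certificate` as the special case of the recipe's moments** (consistency of the two
formats; one line through `Det.formDet_eq_moments`). [cite: Zhang2022LandauSiegel, Prop 7.1 with (8.11)–(8.23), pp.44–50] -/
theorem formDetPSD_of_certificate' (R : DetRecipe) (k11 k22 k11' k22' : ℝ → ℝ) (k12 k12' : ℝ → ℂ)
    (hk11 : ∀ y, HasDerivAt k11 (k11' y) y) (hk22 : ∀ y, HasDerivAt k22 (k22' y) y)
    (hk12 : ∀ y, HasDerivAt k12 (k12' y) y)
    (hc11 : Continuous k11') (hc22 : Continuous k22') (hc12 : Continuous k12')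
    (HP : ∀ y ∈ Icc (0:ℝ) 1, ∀ w v u : ℂ,
      0 ≤ certForm R (k11 y) (k11' y) (k22 y) (k22' y) (k12 y) (k12' y) w v u)
    (HB : ∀ a b : ℂ, 0 ≤ bdForm R (k11 0) (k22 0) (k12 0) a b) :
    FormDetPSD R := by
  intro g g' hg hg1
  rw [formDet_eq_moments hg hg1]
  exact sixMomentOf_nonneg_of_certificate _ _ _ _ _ _ k11 k22 k11' k22' k12 k12' hk11 hk22 hk12 hc11 hc22 hc12
    HP HB hg hg1

/-! ### The certificate form in the `3 × 3` Hermitian shape of `hermForm3_nonneg_of_schur` -/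

/-- **`certFormOf` IS a `3 × 3` Hermitian form of the shape of `Det.hermForm3_nonneg_of_schur`**, with pivot
`r = (2/π)Re m₀`, couplings `p₁ = conj k₁₂`, `p₂ = k₂₂ + i(conj m_s + m_b)` and block `q₁₁ = k₁₁′`,
`q₁₂ = iπ²m_bn + k₁₂′ − k₁₁`, `q₂₂ = 2πRe(m_n + m_bs) + k₂₂′ − 2Re k₁₂` (so an instance proves `certFormOf ≥ 0`
from `s₁₁ > 0`, `det ≥ 0` of the Schur data). `RepairDetShiftPSD`'s `certForm_eq_hermForm3`, in the parameters.
[cite: Zhang2022LandauSiegel, Prop 7.1 with (8.11)–(8.23), pp.44–50] -/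
theorem certFormOf_eq_hermForm3 (m0 ms mn mb mbs mbn : ℂ) (k11 k11' k22 k22' : ℝ) (k12 k12' w v u : ℂ) :
    certFormOf m0 ms mn mb mbs mbn k11 k11' k22 k22' k12 k12' w v u
      = 2 / π * m0.re * ‖u‖ ^ 2
        + 2 * (conj u * (conj k12 * w + ((k22 : ℂ) + I * (conj ms + mb)) * v)).re
        + k11' * ‖w‖ ^ 2
        + 2 * (((I * π ^ 2 * mbn + k12' - k11)) * (conj w * v)).re
        + (2 * π * (mn + mbs).re + k22' - 2 * k12.re) * ‖v‖ ^ 2 := by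
  simp only [certFormOf, pwFormOf, Complex.sq_norm, Complex.normSq_apply, Complex.add_re, Complex.add_im,
    Complex.sub_re, Complex.sub_im, Complex.mul_re, Complex.mul_im, Complex.conj_re, Complex.conj_im,
    Complex.ofReal_re, Complex.ofReal_im, Complex.I_re, Complex.I_im]
  simp only [← Complex.ofReal_pow, Complex.ofReal_re, Complex.ofReal_im]
  ring

/-- **The pointwise hypothesis from the two scalar Schur conditions** (`Det.hermForm3_nonneg_of_schur` applied to
the shape `certFormOf_eq_hermForm3`): with `r = (2/π)Re m₀ > 0`, `p₁ = conj k₁₂`, `p₂ = k₂₂ + i(conj m_s + m_b)`,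
`q₁₁ = k₁₁′`, `q₁₂ = iπ²m_bn + k₁₂′ − k₁₁`, `q₂₂ = 2πRe(m_n + m_bs) + k₂₂′ − 2Re k₁₂`, the conditions
`q₁₁ − |p₁|²/r > 0` and `(q₁₁ − |p₁|²/r)(q₂₂ − |p₂|²/r) − |q₁₂ − conj(p₁)p₂/r|² ≥ 0` give `certFormOf ≥ 0` at the
point. [cite: Zhang2022LandauSiegel, Prop 7.1 with (8.11)–(8.23), pp.44–50] -/
theorem certFormOf_nonneg_of_schur (m0 ms mn mb mbs mbn : ℂ) (k11 k11' k22 k22' : ℝ) (k12 k12' : ℂ)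
    (hr : 0 < 2 / π * m0.re)
    (hs11 : 0 < k11' - ‖conj k12‖ ^ 2 / (2 / π * m0.re))
    (hdet : 0 ≤ (k11' - ‖conj k12‖ ^ 2 / (2 / π * m0.re))
        * ((2 * π * (mn + mbs).re + k22' - 2 * k12.re) - ‖(k22 : ℂ) + I * (conj ms + mb)‖ ^ 2 / (2 / π * m0.re))
        - ‖(I * π ^ 2 * mbn + k12' - k11) - conj (conj k12) * ((k22 : ℂ) + I * (conj ms + mb))
            / ((2 / π * m0.re : ℝ) : ℂ)‖ ^ 2)
    (w v u : ℂ) :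
    0 ≤ certFormOf m0 ms mn mb mbs mbn k11 k11' k22 k22' k12 k12' w v u := by
  rw [certFormOf_eq_hermForm3]
  have h := hermForm3_nonneg_of_schur (r := 2 / π * m0.re) (q11 := k11')
    (q22 := 2 * π * (mn + mbs).re + k22' - 2 * k12.re) (p1 := conj k12)
    (p2 := (k22 : ℂ) + I * (conj ms + mb)) (q12 := I * π ^ 2 * mbn + k12' - k11) hr hs11 hdet w v u
  linarith [h]

/-! ### Corollaries: the confluent recipe forms and the `K = 1` members of the row E-102 -/

/-- **A certificate for the divided-difference moments of ANY real triple proves `FormDetDD b ≥ 0` on one-sided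
kinked profiles** (repeats allowed; `Det.FormDetDD b := SixMomentOf (ddM0 b) (ddMs b) (ddMn b) (ddMb b) (ddMbs b)
(ddMbn b)` — the confluent recipe form of theory ruling (c1)(1), typed in `DetectorShiftMomentsDD`).
[cite: Zhang2022LandauSiegel, proof of Prop 7.1, (7.19)–(7.21); §8 (8.11)–(8.23)] -/
theorem formDetDD_nonneg_of_certificate (b : Fin 3 → ℝ) (k11 k22 k11' k22' : ℝ → ℝ) (k12 k12' : ℝ → ℂ)
    (hk11 : ∀ y, HasDerivAt k11 (k11' y) y) (hk22 : ∀ y, HasDerivAt k22 (k22' y) y)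
    (hk12 : ∀ y, HasDerivAt k12 (k12' y) y)
    (hc11 : Continuous k11') (hc22 : Continuous k22') (hc12 : Continuous k12')
    (HP : ∀ y ∈ Icc (0:ℝ) 1, ∀ w v u : ℂ,
      0 ≤ certFormOf (ddM0 b) (ddMs b) (ddMn b) (ddMb b) (ddMbs b) (ddMbn b)
        (k11 y) (k11' y) (k22 y) (k22' y) (k12 y) (k12' y) w v u)
    (HB : ∀ a c : ℂ, 0 ≤ bdFormOf (ddMn b) (k11 0) (k22 0) (k12 0) a c)
    {g g' : ℝ → ℂ} (hg : KinkedProfile g g') (hg1 : g 1 = 0) :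
    0 ≤ FormDetDD b g g' := by
  unfold FormDetDD
  exact sixMomentOf_nonneg_of_certificate (ddM0 b) (ddMs b) (ddMn b) (ddMb b) (ddMbs b) (ddMbn b)
    k11 k22 k11' k22' k12 k12' hk11 hk22 hk12 hc11 hc22 hc12 HP HB hg hg1

/-- **A certificate for the triple `(a, x, x)` proves the `K = 1` member `ConePSD a ![x]` of the row E-102**
(`Det.conePSD_fin_one_iff`: the single-profile entangled member is the repeated-shift monomial `X_a·X_x²`, whose
main term is `FormDetDD (a,x,x)`). The row `Det.EdetCone` itself is NOT touched (it quantifies over every anchor,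
every finite palette and every profile vector). [cite: Zhang2022LandauSiegel, Prop 7.1 p.44, (7.2), (7.19)–(7.21)] -/
theorem conePSD_fin_one_of_certificate (a x : ℝ) (k11 k22 k11' k22' : ℝ → ℝ) (k12 k12' : ℝ → ℂ)
    (hk11 : ∀ y, HasDerivAt k11 (k11' y) y) (hk22 : ∀ y, HasDerivAt k22 (k22' y) y)
    (hk12 : ∀ y, HasDerivAt k12 (k12' y) y)
    (hc11 : Continuous k11') (hc22 : Continuous k22') (hc12 : Continuous k12')
    (HP : ∀ y ∈ Icc (0:ℝ) 1, ∀ w v u : ℂ,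
      0 ≤ certFormOf (ddM0 ![a, x, x]) (ddMs ![a, x, x]) (ddMn ![a, x, x]) (ddMb ![a, x, x])
        (ddMbs ![a, x, x]) (ddMbn ![a, x, x]) (k11 y) (k11' y) (k22 y) (k22' y) (k12 y) (k12' y) w v u)
    (HB : ∀ a' c : ℂ, 0 ≤ bdFormOf (ddMn ![a, x, x]) (k11 0) (k22 0) (k12 0) a' c) :
    ConePSD a ![x] :=
  (conePSD_fin_one_iff a x).2 fun _ _ hg hg1 =>
    formDetDD_nonneg_of_certificate ![a, x, x] k11 k22 k11' k22' k12 k12' hk11 hk22 hk12 hc11 hc22 hc12 HP HB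
      hg hg1

end Det

end Literature.NumberTheory.LFunctions.Zhang2022
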